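import Mathlib
import HarnessLib
import Summits.NavierStokesRegularity.NavierStokesRegularity.Theorems.TypeIQuarterGateScarEnvelopeTypeIForcedTsaiAlgSoundX
import Summits.NavierStokesRegularity.NavierStokesRegularity.Theorems.TypeIQuarterGateScarEnvelopeTypeIForcedTsaiAlgWitnessMGX16

/-!
# ARM B lane E-exact — the 60-element multi-ℓ + swirl row at the EXACT B₁₀ level, AS A TREE THEOREM: δ/M = 18.228 @16.33

Closers of kernel-checked LANEX-ALG v4 rows — EXACT level `‖ω‖_{L²(B₁₀)}` (incomplete-Beta recurrences) and EXACT residual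
weight `(1+ρ)⁵`; no floor, no majorant — through `AlgRowX.sound` (`…ForcedTsaiAlgSoundX`): certified UPPER bounds on the
forced-Tsai modulus in the tree currency (`ℝ³`, weight `(1+ρ)⁵`, level on `B₁₀`).
WITNESS: the 60-element multi-ℓ + swirl witness (opt16, kit j316377; the witness of the landed MLF16/MG16 rows).
`δ*(16.331) ≤ 297.7` (δ/M = 18.228; v3 18.605 @ 16).
«Near-profiles this good EXIST»; UPPER bounds only; excludes nothing; nothing about NS regularity; 23843 / H3 OPEN.
-/

set_option linter.dupNamespace false

namespace Summit.NavierStokesRegularity.NavierStokesRegularity.Cruxes.ScarEnvelopeTypeI.ForcedTsai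

/-- `δ*(16331/1000) ≤ 297687/1000` ≈ 297.6870 at the EXACT `B₁₀` level `M = 16.331` (Type-I-tail class, exact closure, exact weight; δ/M = 18.228; the v3 row of the same vector: 18.605 @ 16). -/
theorem forcedTsaiModulusLE_algX_MGX_16 : ForcedTsaiModulusLE (16331 / 1000 : ℝ) (297687 / 1000 : ℝ) := by
  have h := algRowXMGX16r0.sound algRowXMGX16r0_checkX
  have hM : algRowXMGX16r0.M = (16331 / 1000) := rfl
  have hδ : algRowXMGX16r0.δ = (297687 / 1000) := rfl
  rw [hM, hδ] at h
  push_cast at h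
  exact h

end Summit.NavierStokesRegularity.NavierStokesRegularity.Cruxes.ScarEnvelopeTypeI.ForcedTsai
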